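import Summits.BirchSwinnertonDyer.BirchSwinnertonDyer.Theorems.PrintCf2SplitBadTwoLineUnrSelmerTransport
import Summits.BirchSwinnertonDyer.BirchSwinnertonDyer.Theorems.PrintCf2SplitBadTwoRestrictedSelmerPairSkeleton
import Literature.NumberTheory.EllipticCurves.KellerYin2024.CharacterSelmerGroups
import Literature.NumberTheory.EllipticCurves.Rubin1991.TwoVariableSelmerCoefficientTwist
import HarnessLib

/-!
# (Q ≠ 0) for S3d, generic packaging: a level-`K` class locally trivial away from `p`, unramified but
# NOT strict at `v̄` restricts to a class of `S_M(K_∞) ∖ 𝔖_{v̄}(K_∞, M)` over any `ℤ_p`-line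
# (helper for crux stmt-BirchSwinnertonDyer-20368 `PrintCf2.SplitBadTwoRankOneOfFacts`; cell `bsd-print-cf2`,
# seat `bsd-line-cf2-p1-w7` g5 — S3d class-(iii) bit «Q = S_{W*}(K*_∞)/𝔖 is infinite», the `N ≠ ⊤` input of
# `StrictDefectInfinite.not_finite_quotient_of_forall_exists_sub_mem`, p691114)

For a `ℤ_p`-line `κ` of a number field `K` (`N = ker κ`, `K_∞ = K̄^N`), a discrete `Γ_K`-module `M`, a place
`v̄ ∣ p`, and a level-`K` class `g ∈ H¹(⊤, M)`:
* `resOfLe_mem_unrSelmer_of_level` — if `g` is locally trivial at every finite `w ∤ p`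
  (`res_{⊤ ⊓ D_w} g = 0`) and UNRAMIFIED at `v̄` (`res_{⊤ ⊓ I_v̄} g = 0`), then `res_N g` lies in the
  Greenberg–Vatsal / Keller–Yin group `unrSelmer κ M v̄ ∅ = S_M(K_∞)` (unramified away from `p` and above
  `v̄`, no condition above the other primes over `p`);
* `resOfLe_not_mem_restrictedSelmerZp_of_level` — if moreover `res_{N ⊓ D_v̄} g ≠ 0` then `res_N g` is NOT
  in Agboola's `𝔖_{v̄}(K_∞, M) = restrictedSelmerZp κ M v̄` (strict at `v̄`);
* **`restrictedSelmerZp_addSubgroupOf_unrSelmer_ne_top_of_level`** — hence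
  `(𝔖_{v̄}(K_∞, M)).addSubgroupOf (S_M(K_∞)) ≠ ⊤`, i.e. `Q := S_M(K_∞)/𝔖 ≠ 0`.

The level-`K` class is supplied on the road-α frame by the Poitou–Tate surjectivity (LS)
(`ConjTransport.locSurjFin_of_poitouTate` with the tree theorem `poitouTate_selmerStructure_duality_holds`
and (FIN) = `RelaxationLift.finite_restrictedSelmerBase_of_frame`) applied to an unramified local class at
`v̄` whose restriction to `N ⊓ D_v̄` is non-zero — on class (iii) (`d ≡ 3 (8)` or `d ≡ 14 (16)`) such a
class exists because `D″ = N ⊓ D_v̄` acts trivially on `W*` there (next file).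

HONEST FRAMING: bookkeeping only; closes nothing (`--supports`).  No named fact, no definition, no `sorry`.
No summit statement is proved by this file; BSD is not proved by any of this.

References: Greenberg–Vatsal 2000 §2 pp. 16–17 (the groups), Cor. 2.3; Agboola 2007 §3 Prop. 3.2;
Greenberg 1989 §1 p. 98 (strict vs Greenberg condition).
-/

-- the summit namespace `Summit.BirchSwinnertonDyer.BirchSwinnertonDyer` repeats the problem name by design (D-0017)
set_option linter.dupNamespace false
set_option autoImplicit false

noncomputable section

open scoped Classical
open NumberField IsDedekindDomain Field
open Literature.NumberTheory.EllipticCurves Literature.NumberTheory.EllipticCurves.GreenbergSelmer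
open Literature.NumberTheory.EllipticCurves.GreenbergVatsal2000 Literature.NumberTheory.EllipticCurves.Castella2018
open Literature.NumberTheory.EllipticCurves.Agboola2007
open Literature.NumberTheory.GaloisRepresentations
open Summit.BirchSwinnertonDyer.BirchSwinnertonDyer.Theorems.PrintCf2

namespace Summit.BirchSwinnertonDyer.BirchSwinnertonDyer.Theorems.PrintCf2.StrictDefectInfinite

variable {K : Type} [Field K] [NumberField K] {p : ℕ} [Fact p.Prime] (κ : ZpExtension K p)
  (M : Type) [AddCommGroup M] [DistribMulAction (absoluteGaloisGroup K) M] [TopologicalSpace M]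
  [DiscreteTopology M] {vbar : HeightOneSpectrum (𝓞 K)}

omit [NumberField K] in
/-- Restriction along a chain `H₁ ≤ H₂ ≤ H₃` (the tree's `resOfLe_comp_holds`, element form). [folklore] -/
private theorem resOfLe_resOfLe {H₁ H₂ H₃ : Subgroup (absoluteGaloisGroup K)} (h₁₂ : H₁ ≤ H₂) (h₂₃ : H₂ ≤ H₃)
    (x : subgroupH1 H₃ M) : resOfLe M h₁₂ (resOfLe M h₂₃ x) = resOfLe M (h₁₂.trans h₂₃) x := by
  rw [← AddMonoidHom.comp_apply, resOfLe_comp_holds]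

/-- **A level-`K` class locally trivial away from `p` and unramified at `v̄` restricts into
`S_M(K_∞) = unrSelmer κ M v̄ ∅`.**  Over `K_∞ = K̄^{ker κ}` its restriction is `conj_σ`-invariant for every
`σ ∈ Γ_K` (inner automorphisms act trivially on `H¹(⊤, ·)`), locally trivial — hence unramified — at every
finite `w ∤ p` (`resOfLe_mem_unramifiedKer_of_mem_awayKer`), satisfies Greenberg's inertia condition for
`M⁺_{v̄} = 0` at `v̄` (`mem_greenbergKer_strictDatum_iff_resOfLe`), and nothing is asked above the other primes
over `p` (`greenbergKer_relaxedDatum_eq_top`). [cite: GreenbergVatsal2000, §2 pp. 16–17] [cite: Greenberg1989, §1 p. 98] -/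
theorem resOfLe_mem_unrSelmer_of_level (hvbar : ((p : ℕ) : 𝓞 K) ∈ vbar.asIdeal)
    (g : subgroupH1 (⊤ : Subgroup (absoluteGaloisGroup K)) M)
    (haway : ∀ w : HeightOneSpectrum (𝓞 K), ((p : ℕ) : 𝓞 K) ∉ w.asIdeal →
      resOfLe M (inf_le_left : ⊤ ⊓ decomp w ≤ ⊤) g = 0)
    (hunr : resOfLe M (inf_le_left : ⊤ ⊓ inertia vbar ≤ ⊤) g = 0) :
    resOfLe M (le_top : κ.kerSubgroup ≤ ⊤) g ∈ KellerYin2024.unrSelmer κ M vbar ∅ := by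
  have hconj : ∀ σ : absoluteGaloisGroup K,
      conjH1 κ.kerSubgroup M σ (resOfLe M (le_top : κ.kerSubgroup ≤ ⊤) g) =
        resOfLe M (le_top : κ.kerSubgroup ≤ ⊤) g := fun σ ↦
    conjH1_resOfLe_of_mem M le_top (Subgroup.mem_top σ) g
  change resOfLe M (le_top : κ.kerSubgroup ≤ ⊤) g ∈
    datumSelmer κ.kerSubgroup M p (AcSelmer.bdpData M p vbar) ∅
  rw [mem_datumSelmer_iff, mem_unramifiedOutside_iff]
  refine ⟨fun w _ hpw σ ↦ ?_, fun v hv σ ↦ ?_⟩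
  · rw [hconj]
    exact resOfLe_mem_unramifiedKer_of_mem_awayKer le_top w (by
      rw [awayKer, AddMonoidHom.mem_ker]; exact haway w hpw)
  · rw [hconj]
    by_cases hv' : v = vbar
    · subst hv'
      rw [AcSelmer.bdpData_self p v hv, mem_greenbergKer_strictDatum_iff_resOfLe, resOfLe_resOfLe M]
      have e : resOfLe M ((inf_le_left : κ.kerSubgroup ⊓ inertia v ≤ κ.kerSubgroup).trans
            (le_top : κ.kerSubgroup ≤ ⊤)) g =
          resOfLe M (inf_le_inf_right (inertia v) (le_top : κ.kerSubgroup ≤ ⊤))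
            (resOfLe M (inf_le_left : ⊤ ⊓ inertia v ≤ ⊤) g) := by
        rw [resOfLe_resOfLe M]
      rw [e, hunr, map_zero]
    · rw [AcSelmer.bdpData_of_ne p vbar hv hv', greenbergKer_relaxedDatum_eq_top]
      exact AddSubgroup.mem_top _

/-- **… and it is NOT in `𝔖_{v̄}(K_∞, M) = restrictedSelmerZp κ M v̄` as soon as its restriction to
`ker κ ⊓ D_{v̄}` is non-zero** (the strict condition at `v̄` fails for the trivial conjugate).
[cite: Agboola2007, §3 (arXiv p0008:L58–68)] [cite: Greenberg1989, §1 p. 98 ("strict")] -/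
theorem resOfLe_not_mem_restrictedSelmerZp_of_level (g : subgroupH1 (⊤ : Subgroup (absoluteGaloisGroup K)) M)
    (hnz : resOfLe M ((inf_le_left : κ.kerSubgroup ⊓ decomp vbar ≤ κ.kerSubgroup).trans
      (le_top : κ.kerSubgroup ≤ ⊤)) g ≠ 0) :
    resOfLe M (le_top : κ.kerSubgroup ≤ ⊤) g ∉ restrictedSelmerZp κ M vbar := by
  intro hmem
  have h := ((RestrictedSelmerPair.mem_restrictedSelmer_iff_resOfLe κ.kerSubgroup M p vbar _).1 hmem).2.2 1
  rw [conjH1_one_holds κ.kerSubgroup M, AddMonoidHom.id_apply, resOfLe_resOfLe M] at h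
  exact hnz h

/-- **(Q ≠ 0): `𝔖_{v̄}(K_∞, M)` is a PROPER subgroup of `S_M(K_∞)`** as soon as there is a level-`K`
class locally trivial at every finite `w ∤ p`, unramified at `v̄`, with non-zero restriction to
`ker κ ⊓ D_{v̄}`: the quotient `Q = S_M(K_∞)/𝔖_{v̄}(K_∞, M)` is non-zero — the hypothesis `hne` of
`not_finite_quotient_of_forall_exists_sub_mem`. (On the road-α frame the class comes from the level-`K`
Poitou–Tate surjectivity (LS) and an unramified local class at `v̄` surviving restriction to the line.)
[cite: GreenbergVatsal2000, §2 Cor. 2.3] [cite: Agboola2007, §3 Prop. 3.2] -/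
theorem restrictedSelmerZp_addSubgroupOf_unrSelmer_ne_top_of_level (hvbar : ((p : ℕ) : 𝓞 K) ∈ vbar.asIdeal)
    (g : subgroupH1 (⊤ : Subgroup (absoluteGaloisGroup K)) M)
    (haway : ∀ w : HeightOneSpectrum (𝓞 K), ((p : ℕ) : 𝓞 K) ∉ w.asIdeal →
      resOfLe M (inf_le_left : ⊤ ⊓ decomp w ≤ ⊤) g = 0)
    (hunr : resOfLe M (inf_le_left : ⊤ ⊓ inertia vbar ≤ ⊤) g = 0)
    (hnz : resOfLe M ((inf_le_left : κ.kerSubgroup ⊓ decomp vbar ≤ κ.kerSubgroup).trans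
      (le_top : κ.kerSubgroup ≤ ⊤)) g ≠ 0) :
    (restrictedSelmerZp κ M vbar).addSubgroupOf (KellerYin2024.unrSelmer κ M vbar ∅) ≠ ⊤ := by
  intro htop
  have hmem : (⟨resOfLe M (le_top : κ.kerSubgroup ≤ ⊤) g, resOfLe_mem_unrSelmer_of_level κ M hvbar g haway hunr⟩ :
      KellerYin2024.unrSelmer κ M vbar ∅) ∈
        (restrictedSelmerZp κ M vbar).addSubgroupOf (KellerYin2024.unrSelmer κ M vbar ∅) := by
    rw [htop]; exact AddSubgroup.mem_top _
  rw [AddSubgroup.mem_addSubgroupOf] at hmem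
  exact resOfLe_not_mem_restrictedSelmerZp_of_level κ M g hnz hmem

end Summit.BirchSwinnertonDyer.BirchSwinnertonDyer.Theorems.PrintCf2.StrictDefectInfinite

end
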